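import Mathlib
import Summits.Ventures.PercRepro2.TypedSepThreeSupport
import Summits.Ventures.PercRepro2.TypedPocketABStates

/-!
# The `{a₃, b}`-pocket class, II: the split and the states of the support (blind cell PercRepro2,
p3 g6, 2026-08-25; `proofs/P3-BRIDGE.md` §11.21)

`SplitP`: the doors `a₃, b` separate the o-side `WO ∋ o` from the b-side `WB ∋ a₁, a₂` (every open
edge of the support within one side, the sides meeting only in the doors, no typed edge within
both).  The b-side state is `SepThree.bSt`; the o-side state `oStP` records `a₃~o`, `b~o`,
`a₃~b` inside the pocket.  The two-door closure lemmas give the seven coordinates and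
`st_eq_pocketSt`.  Own work; standard axioms.
-/

namespace Summit.Ventures.PercRepro2

open UnionCluster

namespace CovForm

namespace PocketAB

open OneTyped TypedA3 Untouched TypedFactor Separated RootBridge SepThree

section Support

open Classical

variable {V : Type*} {E : Type*} [Fintype E] [DecidableEq E]
variable (ends : E → Sym2 V) (o a₁ a₂ a₃ b : V)

/-- **The pocket split**: the doors `a₃, b` separate the o-side `WO ∋ o` from the b-side
`WB ∋ a₁, a₂` in the support `z ∪ F`. -/
structure SplitP (WO WB : Set V) (F : Finset E) (z : Config E) : Prop where
  split : ∀ e, zF F z e = true → e ∈ within ends WO ∨ e ∈ within ends WB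
  cap : ∀ t, t ∈ WO → t ∈ WB → t = a₃ ∨ t = b
  noloop : ∀ e ∈ F, ¬ (e ∈ within ends WO ∧ e ∈ within ends WB)
  oO : o ∈ WO
  a3O : a₃ ∈ WO
  a3B : a₃ ∈ WB
  bO : b ∈ WO
  bB : b ∈ WB
  a1B : a₁ ∈ WB
  a2B : a₂ ∈ WB
  o3 : o ≠ a₃
  ob : o ≠ b
  a13 : a₁ ≠ a₃
  a1b : a₁ ≠ b
  a23 : a₂ ≠ a₃
  a2b : a₂ ≠ b

/-- The o-side state `(p₃, p_b, X)` of a configuration: `a₃ ~ o`, `b ~ o`, `a₃ ~ b` inside `WO`. -/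
noncomputable def oStP (WO : Set V) (x : Config E) : OSt :=
  (decide (Conn ends (withinRestr ends WO x) a₃ o), decide (Conn ends (withinRestr ends WO x) b o),
    decide (Conn ends (withinRestr ends WO x) a₃ b))

variable {ends o a₁ a₂ a₃ b}

omit [Fintype E] [DecidableEq E] in
/-- The o-side state of any configuration is valid (transitivity inside `WO`). -/
lemma validO_oStP (WO : Set V) (x : Config E) : ValidO (oStP ends o a₃ b WO x) = true := by
  rw [validO_iff]
  simp only [oStP, decide_eq_true_eq]
  exact ⟨fun h => conn_trans h.1 (conn_symm h.2), fun h => conn_trans (conn_symm h.2) h.1,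
    fun h => conn_trans h.2 h.1⟩

variable {WO WB : Set V} {F : Finset E} {z : Config E}

omit [Fintype E] in
/-- A configuration below `z ∪ F` has its open edges within a side. -/
lemma split_of_le (h : SplitP ends o a₁ a₂ a₃ b WO WB F z) {x : Config E} (hx : x ≤ zF F z) :
    ∀ e, x e = true → e ∈ within ends WO ∨ e ∈ within ends WB := fun e he =>
  h.split e (by have := hx e; rw [he] at this; exact Bool.eq_true_of_true_le this)

/-! ### The seven coordinates -/

section Coords

variable (h : SplitP ends o a₁ a₂ a₃ b WO WB F z) {x : Config E}
  (hsp : ∀ e, x e = true → e ∈ within ends WO ∨ e ∈ within ends WB)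

omit [Fintype E] [DecidableEq E] in
include hsp in
/-- The split with the roles of the sides exchanged. -/
lemma hsp' : ∀ e, x e = true → e ∈ within ends WB ∨ e ∈ within ends WO := fun e he =>
  (hsp e he).symm

omit [Fintype E] in
include h in
/-- The doors from the b-side. -/
lemma cap' : ∀ t, t ∈ WB → t ∈ WO → t = a₃ ∨ t = b := fun t h1 h2 => h.cap t h2 h1

omit [Fintype E] in
include h hsp in
/-- `a₃ ~ b = X ∨ b₃`. -/
lemma conn_a3b : Conn ends x a₃ b ↔
    Conn ends (withinRestr ends WO x) a₃ b ∨ Conn ends (withinRestr ends WB x) a₃ b :=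
  conn_doors ends hsp h.cap h.a3O h.a3B

omit [Fintype E] in
include h hsp in
/-- `a₂ ~ a₁ = h₁₂ ∨ (D ∧ ((Y ∧ b₂) ∨ (b₁ ∧ h₃₂)))`. -/
lemma conn_a2a1 : Conn ends x a₂ a₁ ↔
    Conn ends (withinRestr ends WB x) a₂ a₁ ∨
      ((Conn ends (withinRestr ends WO x) a₃ b ∨ Conn ends (withinRestr ends WB x) a₃ b) ∧
        ((Conn ends (withinRestr ends WB x) a₁ a₃ ∧ Conn ends (withinRestr ends WB x) a₂ b) ∨
          (Conn ends (withinRestr ends WB x) a₁ b ∧ Conn ends (withinRestr ends WB x) a₂ a₃))) := by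
  have hin := conn_inside ends (hsp' hsp) (cap' h) h.a3B h.a3O h.bB h.bO h.a2B h.a1B
  rw [conn_a3b h hsp] at hin
  rw [hin]
  constructor
  · rintro (hc | ⟨hD, ⟨h23, hb1⟩ | ⟨h2b, h31⟩⟩)
    · exact Or.inl hc
    · exact Or.inr ⟨hD, Or.inr ⟨conn_symm hb1, h23⟩⟩
    · exact Or.inr ⟨hD, Or.inl ⟨conn_symm h31, h2b⟩⟩
  · rintro (hc | ⟨hD, ⟨h13, h2b⟩ | ⟨h1b, h23⟩⟩)
    · exact Or.inl hc
    · exact Or.inr ⟨hD, Or.inr ⟨h2b, conn_symm h13⟩⟩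
    · exact Or.inr ⟨hD, Or.inl ⟨h23, conn_symm h1b⟩⟩

omit [Fintype E] in
include h hsp in
/-- `a₁ ~ a₃ = Y ∨ (D ∧ ((Y ∧ b₃) ∨ b₁))`. -/
lemma conn_a1a3 : Conn ends x a₁ a₃ ↔
    Conn ends (withinRestr ends WB x) a₁ a₃ ∨
      ((Conn ends (withinRestr ends WO x) a₃ b ∨ Conn ends (withinRestr ends WB x) a₃ b) ∧
        ((Conn ends (withinRestr ends WB x) a₁ a₃ ∧ Conn ends (withinRestr ends WB x) a₃ b) ∨
          Conn ends (withinRestr ends WB x) a₁ b)) := by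
  have hin := conn_inside ends (hsp' hsp) (cap' h) h.a3B h.a3O h.bB h.bO h.a1B h.a3B
  rw [conn_a3b h hsp] at hin
  rw [hin]
  constructor
  · rintro (hc | ⟨hD, ⟨h13, hb3⟩ | ⟨h1b, _⟩⟩)
    · exact Or.inl hc
    · exact Or.inr ⟨hD, Or.inl ⟨h13, conn_symm hb3⟩⟩
    · exact Or.inr ⟨hD, Or.inr h1b⟩
  · rintro (hc | ⟨hD, ⟨h13, h3b⟩ | h1b⟩)
    · exact Or.inl hc
    · exact Or.inr ⟨hD, Or.inl ⟨h13, conn_symm h3b⟩⟩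
    · exact Or.inr ⟨hD, Or.inr ⟨h1b, conn_refl _ _ _⟩⟩

omit [Fintype E] in
include h hsp in
/-- `a₂ ~ a₃ = h₃₂ ∨ (D ∧ ((h₃₂ ∧ b₃) ∨ b₂))`. -/
lemma conn_a2a3 : Conn ends x a₂ a₃ ↔
    Conn ends (withinRestr ends WB x) a₂ a₃ ∨
      ((Conn ends (withinRestr ends WO x) a₃ b ∨ Conn ends (withinRestr ends WB x) a₃ b) ∧
        ((Conn ends (withinRestr ends WB x) a₂ a₃ ∧ Conn ends (withinRestr ends WB x) a₃ b) ∨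
          Conn ends (withinRestr ends WB x) a₂ b)) := by
  have hin := conn_inside ends (hsp' hsp) (cap' h) h.a3B h.a3O h.bB h.bO h.a2B h.a3B
  rw [conn_a3b h hsp] at hin
  rw [hin]
  constructor
  · rintro (hc | ⟨hD, ⟨h23, hb3⟩ | ⟨h2b, _⟩⟩)
    · exact Or.inl hc
    · exact Or.inr ⟨hD, Or.inl ⟨h23, conn_symm hb3⟩⟩
    · exact Or.inr ⟨hD, Or.inr h2b⟩
  · rintro (hc | ⟨hD, ⟨h23, h3b⟩ | h2b⟩)
    · exact Or.inl hc
    · exact Or.inr ⟨hD, Or.inl ⟨h23, conn_symm h3b⟩⟩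
    · exact Or.inr ⟨hD, Or.inr ⟨h2b, conn_refl _ _ _⟩⟩

omit [Fintype E] in
include h hsp in
/-- `a₁ ~ b = b₁ ∨ (D ∧ (Y ∨ (b₁ ∧ b₃)))`. -/
lemma conn_a1b : Conn ends x a₁ b ↔
    Conn ends (withinRestr ends WB x) a₁ b ∨
      ((Conn ends (withinRestr ends WO x) a₃ b ∨ Conn ends (withinRestr ends WB x) a₃ b) ∧
        (Conn ends (withinRestr ends WB x) a₁ a₃ ∨
          (Conn ends (withinRestr ends WB x) a₁ b ∧ Conn ends (withinRestr ends WB x) a₃ b))) := by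
  have hin := conn_inside ends (hsp' hsp) (cap' h) h.a3B h.a3O h.bB h.bO h.a1B h.bB
  rw [conn_a3b h hsp] at hin
  rw [hin]
  constructor
  · rintro (hc | ⟨hD, ⟨h13, _⟩ | ⟨h1b, h3b⟩⟩)
    · exact Or.inl hc
    · exact Or.inr ⟨hD, Or.inl h13⟩
    · exact Or.inr ⟨hD, Or.inr ⟨h1b, h3b⟩⟩
  · rintro (hc | ⟨hD, h13 | ⟨h1b, h3b⟩⟩)
    · exact Or.inl hc
    · exact Or.inr ⟨hD, Or.inl ⟨h13, conn_refl _ _ _⟩⟩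
    · exact Or.inr ⟨hD, Or.inr ⟨h1b, h3b⟩⟩

omit [Fintype E] in
include h hsp in
/-- `a₂ ~ b = b₂ ∨ (D ∧ (h₃₂ ∨ (b₂ ∧ b₃)))`. -/
lemma conn_a2b : Conn ends x a₂ b ↔
    Conn ends (withinRestr ends WB x) a₂ b ∨
      ((Conn ends (withinRestr ends WO x) a₃ b ∨ Conn ends (withinRestr ends WB x) a₃ b) ∧
        (Conn ends (withinRestr ends WB x) a₂ a₃ ∨
          (Conn ends (withinRestr ends WB x) a₂ b ∧ Conn ends (withinRestr ends WB x) a₃ b))) := by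
  have hin := conn_inside ends (hsp' hsp) (cap' h) h.a3B h.a3O h.bB h.bO h.a2B h.bB
  rw [conn_a3b h hsp] at hin
  rw [hin]
  constructor
  · rintro (hc | ⟨hD, ⟨h23, _⟩ | ⟨h2b, h3b⟩⟩)
    · exact Or.inl hc
    · exact Or.inr ⟨hD, Or.inl h23⟩
    · exact Or.inr ⟨hD, Or.inr ⟨h2b, h3b⟩⟩
  · rintro (hc | ⟨hD, h23 | ⟨h2b, h3b⟩⟩)
    · exact Or.inl hc
    · exact Or.inr ⟨hD, Or.inl ⟨h23, conn_refl _ _ _⟩⟩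
    · exact Or.inr ⟨hD, Or.inr ⟨h2b, h3b⟩⟩

omit [Fintype E] in
include h hsp in
/-- `a₃ ~ o = p₃ ∨ (D ∧ (p_b ∨ (X ∧ p₃)))`. -/
lemma conn_a3o : Conn ends x a₃ o ↔
    Conn ends (withinRestr ends WO x) a₃ o ∨
      ((Conn ends (withinRestr ends WO x) a₃ b ∨ Conn ends (withinRestr ends WB x) a₃ b) ∧
        (Conn ends (withinRestr ends WO x) b o ∨
          (Conn ends (withinRestr ends WO x) a₃ b ∧ Conn ends (withinRestr ends WO x) a₃ o))) := by
  have hin := conn_inside ends hsp h.cap h.a3O h.a3B h.bO h.bB h.a3O h.oO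
  rw [conn_a3b h hsp] at hin
  rw [hin]
  constructor
  · rintro (hc | ⟨hD, ⟨_, hbo⟩ | ⟨hX, h3o⟩⟩)
    · exact Or.inl hc
    · exact Or.inr ⟨hD, Or.inl hbo⟩
    · exact Or.inr ⟨hD, Or.inr ⟨hX, h3o⟩⟩
  · rintro (hc | ⟨hD, hbo | ⟨hX, h3o⟩⟩)
    · exact Or.inl hc
    · exact Or.inr ⟨hD, Or.inl ⟨conn_refl _ _ _, hbo⟩⟩
    · exact Or.inr ⟨hD, Or.inr ⟨hX, h3o⟩⟩

omit [Fintype E] in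
include h hsp in
/-- `b ~ o = p_b ∨ (D ∧ ((X ∧ p_b) ∨ p₃))`. -/
lemma conn_bo : Conn ends x b o ↔
    Conn ends (withinRestr ends WO x) b o ∨
      ((Conn ends (withinRestr ends WO x) a₃ b ∨ Conn ends (withinRestr ends WB x) a₃ b) ∧
        ((Conn ends (withinRestr ends WO x) a₃ b ∧ Conn ends (withinRestr ends WO x) b o) ∨
          Conn ends (withinRestr ends WO x) a₃ o)) := by
  have hin := conn_inside ends hsp h.cap h.a3O h.a3B h.bO h.bB h.bO h.oO
  rw [conn_a3b h hsp] at hin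
  rw [hin]
  constructor
  · rintro (hc | ⟨hD, ⟨hb3, hbo⟩ | ⟨_, h3o⟩⟩)
    · exact Or.inl hc
    · exact Or.inr ⟨hD, Or.inl ⟨conn_symm hb3, hbo⟩⟩
    · exact Or.inr ⟨hD, Or.inr h3o⟩
  · rintro (hc | ⟨hD, ⟨hX, hbo⟩ | h3o⟩)
    · exact Or.inl hc
    · exact Or.inr ⟨hD, Or.inl ⟨conn_symm hX, hbo⟩⟩
    · exact Or.inr ⟨hD, Or.inr ⟨conn_refl _ _ _, h3o⟩⟩

omit [Fintype E] in
include h hsp in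
/-- `a₁ ~ o` through a door: `(a₁~a₃ ∧ a₃~o) ∨ (a₁~b ∧ b~o)`. -/
lemma conn_a1o : Conn ends x a₁ o ↔
    (Conn ends x a₁ a₃ ∧ Conn ends x a₃ o) ∨ (Conn ends x a₁ b ∧ Conn ends x b o) := by
  have hoB : o ∉ WB := fun hoB => by
    rcases h.cap o h.oO hoB with h3 | hb
    · exact h.o3 h3
    · exact h.ob hb
  constructor
  · intro hc
    exact conn_door ends (hsp' hsp) (cap' h) h.a1B hoB hc
  · rintro (⟨h13, h3o⟩ | ⟨h1b, hbo⟩)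
    · exact conn_trans h13 h3o
    · exact conn_trans h1b hbo

omit [Fintype E] in
include h hsp in
/-- `a₂ ~ o` through a door: `(a₂~a₃ ∧ a₃~o) ∨ (a₂~b ∧ b~o)`. -/
lemma conn_a2o : Conn ends x a₂ o ↔
    (Conn ends x a₂ a₃ ∧ Conn ends x a₃ o) ∨ (Conn ends x a₂ b ∧ Conn ends x b o) := by
  have hoB : o ∉ WB := fun hoB => by
    rcases h.cap o h.oO hoB with h3 | hb
    · exact h.o3 h3
    · exact h.ob hb
  constructor
  · intro hc
    exact conn_door ends (hsp' hsp) (cap' h) h.a2B hoB hc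
  · rintro (⟨h23, h3o⟩ | ⟨h2b, hbo⟩)
    · exact conn_trans h23 h3o
    · exact conn_trans h2b hbo

end Coords

omit [Fintype E] in
/-- **The state of a copy of the support is the gluing of its side states.** -/
theorem st_eq_pocketSt (h : SplitP ends o a₁ a₂ a₃ b WO WB F z) {x : Config E}
    (hx : x ≤ zF F z) :
    st ends o a₁ a₂ a₃ b x = gluedP (oStP ends o a₃ b WO x) (bSt ends a₁ a₂ a₃ b WB x) := by
  have hsp := split_of_le h hx
  have e1 := conn_a2a1 h hsp
  have e2 := conn_a1o h hsp
  have e3 := conn_a2o h hsp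
  have e4 := conn_a1b h hsp
  have e5 := conn_a2b h hsp
  have e6 := conn_a1a3 h hsp
  have e7 := conn_a2a3 h hsp
  have e8 := conn_a3o h hsp
  have e9 := conn_bo h hsp
  rw [e6, e4, e8, e9] at e2
  rw [e7, e5, e8, e9] at e3
  unfold st gluedP oStP bSt
  rw [decide_eq_decide.mpr e1, decide_eq_decide.mpr e2, decide_eq_decide.mpr e3,
    decide_eq_decide.mpr e4, decide_eq_decide.mpr e5, decide_eq_decide.mpr e6,
    decide_eq_decide.mpr e7]
  simp only [Bool.decide_or, Bool.decide_and]
  all_goals infer_instance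

end Support

end PocketAB

end CovForm

end Summit.Ventures.PercRepro2
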